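import Mathlib
import Literature.GroupTheory.PermutationGroups.SmallIndexSubgroups

/-!
# Entropy support theorem, layer 1: arithmetic and labellings

Helper file for stub `entropySupportTheorem` of crux `SymmetryBudget.WindowBarrier`
(item stmt-PneNP-2145, line `bijection-gauge-twin-iso`).  Pure arithmetic and finite
combinatorics, no group theory yet:

* `est_factorial_pow_mul_factorial_sq_le` — `(a!)^b · (b!)² ≤ (ab)!` for `a ≥ 2` (the order of the
  wreath product `S_a ≀ S_b`, times an extra `b!`, against `|S_{ab}|`);
* `EST.sq_le_two_pow_mul_factorial` — the index form of Bochert's bound `⌈a/2⌉! · p ≤ a!` gives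
  `p² ≤ 2^a · a!`; `EST.sq_le_of_small` — the same shape for `a ≤ 4`;
* labellings `μ : β → ℕ` and their class products
  `∏_{i < N} |{u | μ u = i}|!`: an injective labelling has product `1`
  (`EST.prod_eq_one_of_injective`), a labelling by the blocks of a partition into `b` blocks of
  size `a` has product `(a!)^b` (`EST.exists_block_labelling`), and labellings of a set and of its
  complement combine (`EST.exists_combined_labelling`);
* `EST.eq_one_of_moved_subsingleton` — a permutation all of whose moved points coincide is `1`.

No definitions (kernel-only helper file).
-/

-- `Summit.PneNP.PneNP.…` duplicates `PneNP` BY DESIGN (single-problem summit).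
set_option linter.dupNamespace false

namespace Summit.PneNP.PneNP.Theorems

open Equiv Equiv.Perm

/-- **`(a!)^b · (b!)² ≤ (ab)!` for `a ≥ 2`.**  Induction on `a`: the base `2^b (b!)² ≤ (2b)!` by
induction on `b`, the step through `(ab + 1)^b (ab)! ≤ (ab + b)!`. -/
theorem est_factorial_pow_mul_factorial_sq_le :
    ∀ a b : ℕ, 2 ≤ a → a.factorial ^ b * b.factorial ^ 2 ≤ (a * b).factorial := by
  -- base case `a = 2`
  have base : ∀ b : ℕ, 2 ^ b * b.factorial ^ 2 ≤ (2 * b).factorial := by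
    intro b
    induction b with
    | zero => simp
    | succ b ih =>
      have e1 : (2 * (b + 1)).factorial = (2 * b + 1 + 1) * ((2 * b + 1) * (2 * b).factorial) := by
        rw [show 2 * (b + 1) = 2 * b + 1 + 1 from by ring, Nat.factorial_succ, Nat.factorial_succ]
      have h1 : 2 * (b + 1) ^ 2 ≤ (2 * b + 1 + 1) * (2 * b + 1) := by nlinarith
      rw [e1, Nat.factorial_succ b]
      calc 2 ^ (b + 1) * ((b + 1) * b.factorial) ^ 2
          = (2 * (b + 1) ^ 2) * (2 ^ b * b.factorial ^ 2) := by ring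
        _ ≤ ((2 * b + 1 + 1) * (2 * b + 1)) * (2 * b).factorial := Nat.mul_le_mul h1 ih
        _ = (2 * b + 1 + 1) * ((2 * b + 1) * (2 * b).factorial) := by ring
  intro a b ha
  induction a, ha using Nat.le_induction with
  | base => simpa [Nat.factorial_two] using base b
  | succ a ha ih =>
    rcases Nat.eq_zero_or_pos b with rfl | hb
    · simp
    · have hgrow := Literature.GroupTheory.PermutationGroups.pow_mul_factorial_le_factorial (a * b) b
      -- `(ab + 1)^b (ab)! ≤ (ab + b)!`
      have hpow : (a + 1) ^ b ≤ (a * b + 1) ^ b :=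
        Nat.pow_le_pow_left (by nlinarith) _
      rw [show (a + 1) * b = a * b + b from by ring, Nat.factorial_succ, mul_pow]
      calc ((a + 1) ^ b * a.factorial ^ b) * b.factorial ^ 2
          = (a + 1) ^ b * (a.factorial ^ b * b.factorial ^ 2) := by ring
        _ ≤ (a * b + 1) ^ b * (a * b).factorial := Nat.mul_le_mul hpow ih
        _ ≤ (a * b + b).factorial := hgrow

namespace EST

/-- **Bochert's index bound in squared form**: if `⌊(a+1)/2⌋! · p ≤ a!` then `p² ≤ 2^a · a!`
(because `a! = C(a, ⌊a/2⌋) · ⌊a/2⌋! · ⌈a/2⌉! ≤ 2^a (⌈a/2⌉!)²`). -/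
theorem sq_le_two_pow_mul_factorial {a p : ℕ} (h : ((a + 1) / 2).factorial * p ≤ a.factorial) :
    p ^ 2 ≤ 2 ^ a * a.factorial := by
  set h₂ := (a + 1) / 2 with hh₂
  have hsub : a - a / 2 = h₂ := by omega
  have hfac : a.choose (a / 2) * ((a / 2).factorial * (a - a / 2).factorial) = a.factorial := by
    rw [← mul_assoc]; exact Nat.choose_mul_factorial_mul_factorial (Nat.div_le_self _ _)
  have h1 : (a / 2).factorial ≤ h₂.factorial := Nat.factorial_le (by omega)
  have hle : a.factorial ≤ 2 ^ a * (h₂.factorial * h₂.factorial) := by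
    rw [← hfac, hsub]
    exact Nat.mul_le_mul (Nat.choose_le_two_pow _ _) (Nat.mul_le_mul_right _ h1)
  have hpos : 0 < h₂.factorial * h₂.factorial := Nat.mul_pos (Nat.factorial_pos _) (Nat.factorial_pos _)
  have key : p ^ 2 * (h₂.factorial * h₂.factorial) ≤ 2 ^ a * a.factorial * (h₂.factorial * h₂.factorial) :=
    calc p ^ 2 * (h₂.factorial * h₂.factorial) = (h₂.factorial * p) * (h₂.factorial * p) := by ring
      _ ≤ a.factorial * a.factorial := Nat.mul_le_mul h h
      _ ≤ a.factorial * (2 ^ a * (h₂.factorial * h₂.factorial)) := Nat.mul_le_mul_left _ hle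
      _ = 2 ^ a * a.factorial * (h₂.factorial * h₂.factorial) := by ring
  exact Nat.le_of_mul_le_mul_right key hpos

/-- Small degrees: `p ≤ a!` and `a ≤ 4` give `p² ≤ 2^{5a} · a!`. -/
theorem sq_le_of_small {a p : ℕ} (hp : p ≤ a.factorial) (ha : a ≤ 4) :
    p ^ 2 ≤ 2 ^ (5 * a) * a.factorial := by
  have h24 : a.factorial ≤ 2 ^ (5 * a) := by
    interval_cases a <;> decide
  calc p ^ 2 = p * p := pow_two p
    _ ≤ a.factorial * a.factorial := Nat.mul_le_mul hp hp
    _ ≤ 2 ^ (5 * a) * a.factorial := Nat.mul_le_mul_right _ h24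

/-- The uniform squared bound used for the "small block group" case:
either `a ≤ 4` (and `p ≤ a!`) or Bochert's `⌊(a+1)/2⌋! · p ≤ a!`; in both cases
`p² ≤ 2^{5a} · a!`. -/
theorem sq_le_two_pow_five_mul_factorial {a p : ℕ} (hp : p ≤ a.factorial)
    (h : a ≤ 4 ∨ ((a + 1) / 2).factorial * p ≤ a.factorial) :
    p ^ 2 ≤ 2 ^ (5 * a) * a.factorial := by
  rcases h with h | h
  · exact sq_le_of_small hp h
  · calc p ^ 2 ≤ 2 ^ a * a.factorial := sq_le_two_pow_mul_factorial h
      _ ≤ 2 ^ (5 * a) * a.factorial :=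
          Nat.mul_le_mul_right _ (Nat.pow_le_pow_right (by norm_num) (by omega))

/-! ### Labellings and their class products -/

/-- An injective labelling has all classes of size `≤ 1`, so its class product is `1`. -/
theorem prod_eq_one_of_injective {β : Type*} [Fintype β] [DecidableEq β] (μ : β → ℕ)
    (hμ : Function.Injective μ) (N : ℕ) :
    ∏ i ∈ Finset.range N, ((Finset.univ.filter fun u : β => μ u = i).card).factorial = 1 := by
  refine Finset.prod_eq_one fun i _ => ?_
  rw [Nat.factorial_eq_one]
  refine Finset.card_le_one.2 fun u hu v hv => ?_
  rw [Finset.mem_filter] at hu hv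
  exact hμ (hu.2.trans hv.2.symm)

/-- Every finite type carries an injective labelling with labels below its cardinality. -/
theorem exists_injective_labelling (β : Type*) [Fintype β] :
    ∃ μ : β → ℕ, Function.Injective μ ∧ ∀ u, μ u < Fintype.card β :=
  ⟨fun u => (Fintype.equivFin β u : ℕ),
    fun _ _ h => (Fintype.equivFin β).injective (Fin.ext h), fun u => (Fintype.equivFin β u).2⟩

/-- A permutation whose moved points all coincide is the identity. -/
theorem eq_one_of_moved_subsingleton {β : Type*} (σ : Perm β)
    (h : ∀ u v, σ u ≠ u → σ v ≠ v → u = v) : σ = 1 := by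
  ext u
  by_contra hu
  have hv : σ (σ u) ≠ σ u := fun e => hu (σ.injective e)
  exact hu (h _ _ hv hu)

/-- **Block labelling.**  A partition of a finite type into `b` blocks of size `a` (given as a
finite set `S` of pairwise disjoint covering finite sets) is the class partition of a labelling
with labels `< b`, whose classes are exactly the blocks and whose class product is `(a!)^b`. -/
theorem exists_block_labelling {β : Type*} [Fintype β] [DecidableEq β] (S : Finset (Finset β))
    (a : ℕ) (hsize : ∀ C ∈ S, C.card = a) (hcover : ∀ u, ∃ C ∈ S, u ∈ C)
    (hdisj : ∀ C ∈ S, ∀ C' ∈ S, C ≠ C' → Disjoint C C') :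
    ∃ μ : β → ℕ, (∀ u, μ u < S.card) ∧ (∀ i, i < S.card → ∃ C ∈ S, ∀ u, μ u = i ↔ u ∈ C) ∧
      ∏ i ∈ Finset.range S.card, ((Finset.univ.filter fun u : β => μ u = i).card).factorial =
        a.factorial ^ S.card := by
  classical
  choose blk hblkS hblk using hcover
  set e := S.equivFin with he
  let μ : β → ℕ := fun u => (e ⟨blk u, hblkS u⟩ : ℕ)
  have hclass : ∀ i (hi : i < S.card), ∀ u, μ u = i ↔ u ∈ ((e.symm ⟨i, hi⟩ : {C // C ∈ S}) : Finset β) := by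
    intro i hi u
    constructor
    · intro hμ
      have h1 : e ⟨blk u, hblkS u⟩ = ⟨i, hi⟩ := Fin.ext hμ
      have h2 : (⟨blk u, hblkS u⟩ : {C // C ∈ S}) = e.symm ⟨i, hi⟩ := by
        rw [← h1, Equiv.symm_apply_apply]
      rw [← h2]
      exact hblk u
    · intro hu
      have hCS : ((e.symm ⟨i, hi⟩ : {C // C ∈ S}) : Finset β) ∈ S := (e.symm ⟨i, hi⟩).2
      have heq : blk u = ((e.symm ⟨i, hi⟩ : {C // C ∈ S}) : Finset β) := by
        by_contra hne
        exact Finset.disjoint_left.1 (hdisj _ (hblkS u) _ hCS hne) (hblk u) hu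
      have h3 : (⟨blk u, hblkS u⟩ : {C // C ∈ S}) = e.symm ⟨i, hi⟩ := Subtype.ext heq
      show (e ⟨blk u, hblkS u⟩ : ℕ) = i
      rw [h3, Equiv.apply_symm_apply]
  refine ⟨μ, fun u => (e ⟨blk u, hblkS u⟩).2, fun i hi => ⟨_, (e.symm ⟨i, hi⟩).2, hclass i hi⟩, ?_⟩
  rw [← Finset.card_range S.card, ← Finset.prod_const, Finset.card_range]
  refine Finset.prod_congr rfl fun i hi => ?_
  rw [Finset.mem_range] at hi
  congr 1
  rw [← hsize _ (e.symm ⟨i, hi⟩).2]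
  congr 1
  ext u
  simp only [Finset.mem_filter, Finset.mem_univ, true_and]
  exact hclass i hi u

/-- **Combining labellings of a set and of its complement.**  Labels of `O` come first, labels of
the complement are shifted by `N₁`; the class product is the product of the two class products. -/
theorem exists_combined_labelling {α : Type*} [Fintype α] [DecidableEq α] (O : Finset α)
    (N₁ N₂ : ℕ) (μ₁ : {x // x ∈ O} → ℕ) (μ₂ : {x // x ∉ O} → ℕ) (h₁ : ∀ v, μ₁ v < N₁)
    (h₂ : ∀ v, μ₂ v < N₂) :
    ∃ μ : α → ℕ, (∀ u, μ u < N₁ + N₂) ∧ (∀ u (h : u ∈ O), μ u = μ₁ ⟨u, h⟩) ∧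
      (∀ u (h : u ∉ O), μ u = N₁ + μ₂ ⟨u, h⟩) ∧
      ∏ i ∈ Finset.range (N₁ + N₂), ((Finset.univ.filter fun u : α => μ u = i).card).factorial =
        (∏ i ∈ Finset.range N₁,
            ((Finset.univ.filter fun v : {x // x ∈ O} => μ₁ v = i).card).factorial) *
          ∏ i ∈ Finset.range N₂,
            ((Finset.univ.filter fun v : {x // x ∉ O} => μ₂ v = i).card).factorial := by
  let μ : α → ℕ := fun u => if h : u ∈ O then μ₁ ⟨u, h⟩ else N₁ + μ₂ ⟨u, h⟩
  have hμO : ∀ u (h : u ∈ O), μ u = μ₁ ⟨u, h⟩ := fun u h => by simp [μ, h]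
  have hμR : ∀ u (h : u ∉ O), μ u = N₁ + μ₂ ⟨u, h⟩ := fun u h => by simp [μ, h]
  refine ⟨μ, fun u => ?_, hμO, hμR, ?_⟩
  · by_cases h : u ∈ O
    · rw [hμO u h]; have := h₁ ⟨u, h⟩; omega
    · rw [hμR u h]; have := h₂ ⟨u, h⟩; omega
  rw [Finset.prod_range_add]
  congr 1
  · refine Finset.prod_congr rfl fun i hi => ?_
    rw [Finset.mem_range] at hi
    congr 1
    have : (Finset.univ.filter fun u : α => μ u = i) =
        (Finset.univ.filter fun v : {x // x ∈ O} => μ₁ v = i).map (Function.Embedding.subtype _) := by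
      ext u
      constructor
      · intro hu
        rw [Finset.mem_filter] at hu
        rw [Finset.mem_map]
        by_cases h : u ∈ O
        · refine ⟨⟨u, h⟩, ?_, rfl⟩
          rw [Finset.mem_filter, ← hμO u h]
          exact ⟨Finset.mem_univ _, hu.2⟩
        · rw [hμR u h] at hu; omega
      · intro hu
        rw [Finset.mem_map] at hu
        obtain ⟨v, hv, rfl⟩ := hu
        rw [Finset.mem_filter] at hv ⊢
        refine ⟨Finset.mem_univ _, ?_⟩
        show μ v.1 = i
        rw [hμO v.1 v.2]; exact hv.2
    rw [this, Finset.card_map]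
  · refine Finset.prod_congr rfl fun i _ => ?_
    congr 1
    have : (Finset.univ.filter fun u : α => μ u = N₁ + i) =
        (Finset.univ.filter fun v : {x // x ∉ O} => μ₂ v = i).map (Function.Embedding.subtype _) := by
      ext u
      constructor
      · intro hu
        rw [Finset.mem_filter] at hu
        rw [Finset.mem_map]
        by_cases h : u ∈ O
        · rw [hμO u h] at hu; have := h₁ ⟨u, h⟩; omega
        · refine ⟨⟨u, h⟩, ?_, rfl⟩
          rw [Finset.mem_filter]
          refine ⟨Finset.mem_univ _, ?_⟩
          rw [hμR u h] at hu; omega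
      · intro hu
        rw [Finset.mem_map] at hu
        obtain ⟨v, hv, rfl⟩ := hu
        rw [Finset.mem_filter] at hv ⊢
        refine ⟨Finset.mem_univ _, ?_⟩
        show μ v.1 = N₁ + i
        rw [hμR v.1 v.2, hv.2]
    rw [this, Finset.card_map]

/-- The class product over `range N` is at most the class product over the set of labels actually
taken (classes of untaken labels are empty, `0! = 1`). -/
theorem prod_range_le_prod_image {β : Type*} [Fintype β] [DecidableEq β] (μ : β → ℕ) (N : ℕ) :
    ∏ i ∈ Finset.range N, ((Finset.univ.filter fun u : β => μ u = i).card).factorial ≤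
      ∏ i ∈ Finset.univ.image μ, ((Finset.univ.filter fun u : β => μ u = i).card).factorial := by
  have h1 : ∏ i ∈ Finset.range N, ((Finset.univ.filter fun u : β => μ u = i).card).factorial =
      ∏ i ∈ Finset.range N ∩ Finset.univ.image μ,
        ((Finset.univ.filter fun u : β => μ u = i).card).factorial := by
    refine (Finset.prod_subset Finset.inter_subset_left fun i hi hi' => ?_).symm
    have hi'' : i ∉ Finset.univ.image μ := fun h => hi' (Finset.mem_inter.2 ⟨hi, h⟩)
    have : (Finset.univ.filter fun u : β => μ u = i) = ∅ := by
      rw [Finset.filter_eq_empty_iff]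
      intro u _ hu
      exact hi'' (Finset.mem_image.2 ⟨u, Finset.mem_univ _, hu⟩)
    rw [this, Finset.card_empty, Nat.factorial_zero]
  rw [h1]
  exact Finset.prod_le_prod_of_subset_of_one_le' Finset.inter_subset_right
    fun i _ _ => Nat.one_le_iff_ne_zero.2 (Nat.factorial_ne_zero _)

end EST

end Summit.PneNP.PneNP.Theorems
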